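import Mathlib
import Summits.Ventures.PercRepro2.LeafRowPendantRootSO

/-!
# Positive association of the explored root cluster at second order: `crossAso ≥ 0`
(blind cell PercRepro2, p5 g30; `proofs/P5-OEDGE.md` §40)

Tools: the `Q`-indicator `1[a₁ ∉ C(a₂)]` is `g_univ(C(a₂))`; the tower identities of `BHKOutside`
with the explicit `Q`-indicator (`expect_outside_Q`, `expect_indicator_Q`); the monotonicity slack
`π_x − g_x(K)` (`g_x(K) = P(a₁ ↔ x in G ∖ K)`) is monotone and nonnegative in `K`
(`slackFun_mono`, `slackFun_nonneg`); the indicator `1[x ∈ K]` is monotone.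

**`crossAso ≥ 0`** (`crossAso_nonneg`): with `Z = P(Q)`,
`crossAso = [Z·crossAfo − (π_o P(Q,vH) − P(Q,vH,oL))·(π_b Z − P(Q,bL))]
          + [Z·crossAfo − (π_b P(Q,vH) − P(Q,vH,bL))·(π_o Z − P(Q,oL))]`
and each bracket is nonnegative: `crossAfo ≥ E[1[v ∈ K](π_o − g_o)(π_b − g_b); Q]` (Harris in
`G ∖ K`, `crossAfo_ge`) and `Z·E[F₁F₂; Q] ≥ E[F₁; Q]·E[F₂; Q]` for the monotone nonnegative
`F₁ = 1[v ∈ ·](π_o − g_o)`, `F₂ = π_b − g_b` — the functional BHK inequality `bhk_univ_avoid`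
(BHK06 Thm 1.3, positive association of `C(a₂)` conditionally on `a₁ ∉ C(a₂)`).  Own work;
standard axioms.
-/

namespace Summit.Ventures.PercRepro2

open UnionCluster CovForm CovForm.FirstOrder LeafStep LeafHalfCross LeafRowEdgeCubic
  LeafRowFirstOrderA LeafRowPendantRootFO LeafRowPendantRootSO

namespace LeafRowPendantRootSOPA

section Tools

variable {V : Type*} {E : Type*} [Fintype E] [DecidableEq E] [Fintype V] [DecidableEq V]
  {R : Type*} [Field R] [LinearOrder R] [IsStrictOrderedRing R]
variable (q : E → R) (ends : E → Sym2 V)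

omit [Fintype V] [DecidableEq V] [LinearOrder R] [IsStrictOrderedRing R] in
/-- The `Q`-indicator is `g_univ(C(a₂)) = 1[a₁ ∉ C(a₂)]`. -/
lemma indicator_Q_eq_outsideProb_univ (a₁ a₂ : V) (ω : Config E) :
    (avoidAll ends a₂ {a₁}).indicator (1 : Config E → R) ω =
      outsideProb q ends a₁ Set.univ (cluster ends ω a₂) := by
  by_cases ha : a₁ ∈ cluster ends ω a₂
  · rw [outsideProb_apply_of_mem q _ ha]
    have hn : ω ∉ avoidAll ends a₂ {a₁} := fun h => h a₁ (Finset.mem_singleton_self a₁) (mem_cluster.1 ha)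
    rw [Set.indicator_of_notMem hn]
  · rw [outsideProb_apply_of_notMem q _ ha, delClusterProb_univ]
    have hm : ω ∈ avoidAll ends a₂ {a₁} := fun x hx => by
      rw [Finset.mem_singleton] at hx; rw [hx]; exact fun hc => ha (mem_cluster.2 hc)
    rw [Set.indicator_of_mem hm, Pi.one_apply]

omit [Fintype V] [DecidableEq V] [LinearOrder R] [IsStrictOrderedRing R] in
/-- `g_𝓥(C(a₂))` already vanishes off `Q`. -/
lemma outsideProb_mul_indicator_Q (a₁ a₂ : V) (𝓥 : Set (Set V)) (ω : Config E) :
    outsideProb q ends a₁ 𝓥 (cluster ends ω a₂) * (avoidAll ends a₂ {a₁}).indicator (1 : Config E → R) ω =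
      outsideProb q ends a₁ 𝓥 (cluster ends ω a₂) := by
  by_cases ha : a₁ ∈ cluster ends ω a₂
  · rw [outsideProb_apply_of_mem q _ ha, zero_mul]
  · have hm : ω ∈ avoidAll ends a₂ {a₁} := fun x hx => by
      rw [Finset.mem_singleton] at hx; rw [hx]; exact fun hc => ha (mem_cluster.2 hc)
    rw [Set.indicator_of_mem hm, Pi.one_apply, mul_one]

omit [LinearOrder R] [IsStrictOrderedRing R] in
/-- **Tower identity with the explicit `Q`-indicator**:
`E[1_𝓤(K)·g_𝓥(K)·1_Q] = P(C(a₂) ∈ 𝓤, C(a₁) ∈ 𝓥, Q)`. -/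
lemma expect_outside_Q (a₁ a₂ : V) (𝓤 𝓥 : Set (Set V)) :
    expect q (fun ω => 𝓤.indicator 1 (cluster ends ω a₂) * outsideProb q ends a₁ 𝓥 (cluster ends ω a₂) *
        (avoidAll ends a₂ {a₁}).indicator (1 : Config E → R) ω) =
      prob q (clusterInEvent ends a₂ 𝓤 ∩ clusterInEvent ends a₁ 𝓥 ∩ avoidAll ends a₂ {a₁}) := by
  have h := prob_clusterIn_outside_inter_avoid_eq_expect q ends a₂ a₁ ∅ 𝓤 𝓥
  rw [Finset.insert_empty, avoidAll_empty] at h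
  rw [h]
  congr 1
  funext ω
  rw [mul_assoc, outsideProb_mul_indicator_Q, Set.indicator_univ, Pi.one_apply, mul_one]

omit [LinearOrder R] [IsStrictOrderedRing R] in
/-- `E[1_𝓤(K)·1_Q] = P(C(a₂) ∈ 𝓤, Q)`. -/
lemma expect_indicator_Q (a₁ a₂ : V) (𝓤 : Set (Set V)) :
    expect q (fun ω => 𝓤.indicator 1 (cluster ends ω a₂) *
        (avoidAll ends a₂ {a₁}).indicator (1 : Config E → R) ω) =
      prob q (clusterInEvent ends a₂ 𝓤 ∩ avoidAll ends a₂ {a₁}) := by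
  have h := expect_outside_Q q ends a₁ a₂ 𝓤 Set.univ
  rw [clusterInEvent_univ, Set.inter_univ] at h
  rw [← h]
  congr 1
  funext ω
  rw [← indicator_Q_eq_outsideProb_univ, mul_assoc]
  by_cases hm : ω ∈ avoidAll ends a₂ {a₁}
  · rw [Set.indicator_of_mem hm, Pi.one_apply]; ring
  · rw [Set.indicator_of_notMem hm]; ring

omit [Fintype V] [DecidableEq V] in
/-- The monotonicity slack `π_x − g_x` is monotone. -/
lemma slackFun_mono (hq : IsProbVec q) (a₁ x : V) :
    Monotone (fun W : Set V => prob q (connEvent ends a₁ x) - outsideProb q ends a₁ {W | x ∈ W} W) :=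
  fun W W' h => by
    have := outsideProb_anti hq ends a₁ (isUpperSet_mem_setOf x) h
    simp only
    linarith

omit [Fintype V] [DecidableEq V] in
/-- The monotonicity slack `π_x − g_x` is nonnegative. -/
lemma slackFun_nonneg (hq : IsProbVec q) (a₁ x : V) (W : Set V) :
    0 ≤ prob q (connEvent ends a₁ x) - outsideProb q ends a₁ {W | x ∈ W} W := by
  by_cases ha : a₁ ∈ W
  · rw [outsideProb_apply_of_mem q _ ha, sub_zero]
    exact prob_nonneg hq _
  · rw [outsideProb_apply_of_notMem q _ ha]
    have := delClusterProb_le_beta q hq ends a₁ x W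
    unfold beta at this
    linarith

omit [Fintype V] [DecidableEq V] in
/-- The indicator of an up-set family is monotone. -/
lemma indicator_mem_mono (x : V) :
    Monotone (fun W : Set V => ({W : Set V | x ∈ W}.indicator (1 : Set V → R) W)) := fun W W' h => by
  simp only
  by_cases hW : W ∈ {W : Set V | x ∈ W}
  · have hW' : W' ∈ {W : Set V | x ∈ W} := h hW
    rw [Set.indicator_of_mem hW, Set.indicator_of_mem hW', Pi.one_apply, Pi.one_apply]
  · rw [Set.indicator_of_notMem hW]
    exact Set.indicator_apply_nonneg fun _ => zero_le_one

omit [Fintype V] [DecidableEq V] in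
/-- The indicator is nonnegative. -/
lemma indicator_mem_nonneg (x : V) (W : Set V) :
    0 ≤ ({W : Set V | x ∈ W}.indicator (1 : Set V → R) W) :=
  Set.indicator_apply_nonneg fun _ => zero_le_one

end Tools

section CrossA

variable {V : Type*} {E : Type*} [Fintype E] [DecidableEq E] [Fintype V] [DecidableEq V]
  {R : Type*} [Field R] [LinearOrder R] [IsStrictOrderedRing R]
variable (q : E → R) (ends : E → Sym2 V)

omit [LinearOrder R] [IsStrictOrderedRing R] in
/-- `E[1[v ∈ K]·(π_o − g_o(K))·1_Q] = π_o·P(Q, vH) − P(Q, vH, oL)`. -/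
lemma expect_vslack (a₁ a₂ v o : V) :
    expect q (fun ω => ({W : Set V | v ∈ W}.indicator 1 (cluster ends ω a₂) *
        (prob q (connEvent ends a₁ o) - outsideProb q ends a₁ {W | o ∈ W} (cluster ends ω a₂))) *
        (avoidAll ends a₂ {a₁}).indicator (1 : Config E → R) ω) =
      prob q (connEvent ends a₁ o) * prob q (avoidAll ends a₂ {a₁} ∩ connEvent ends a₂ v) -
        prob q (avoidAll ends a₂ {a₁} ∩ (connEvent ends a₂ v ∩ connEvent ends a₁ o)) := by
  have e1 : avoidAll ends a₂ {a₁} ∩ connEvent ends a₂ v =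
      clusterInEvent ends a₂ {W | v ∈ W} ∩ avoidAll ends a₂ {a₁} := by
    ext ω
    simp only [Set.mem_inter_iff, mem_connEvent, clusterInEvent, Set.mem_setOf_eq, mem_cluster]
    tauto
  have e2 : avoidAll ends a₂ {a₁} ∩ (connEvent ends a₂ v ∩ connEvent ends a₁ o) =
      clusterInEvent ends a₂ {W | v ∈ W} ∩ clusterInEvent ends a₁ {W | o ∈ W} ∩
        avoidAll ends a₂ {a₁} := by
    ext ω
    simp only [Set.mem_inter_iff, mem_connEvent, clusterInEvent, Set.mem_setOf_eq, mem_cluster]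
    tauto
  rw [e1, e2, ← expect_indicator_Q, ← expect_outside_Q, ← expect_const_mul, ← expect_sub]
  congr 1
  funext ω
  simp only [Pi.sub_apply]
  ring

omit [LinearOrder R] [IsStrictOrderedRing R] in
/-- `E[(π_b − g_b(K))·1_Q] = π_b·Z − P(Q, bL)`. -/
lemma expect_slack (a₁ a₂ b : V) :
    expect q (fun ω =>
        (prob q (connEvent ends a₁ b) - outsideProb q ends a₁ {W | b ∈ W} (cluster ends ω a₂)) *
        (avoidAll ends a₂ {a₁}).indicator (1 : Config E → R) ω) =
      prob q (connEvent ends a₁ b) * prob q (avoidAll ends a₂ {a₁}) -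
        prob q (avoidAll ends a₂ {a₁} ∩ connEvent ends a₁ b) := by
  have h1 := expect_indicator_Q q ends a₁ a₂ Set.univ
  rw [clusterInEvent_univ, Set.univ_inter] at h1
  have h2 := expect_outside_Q q ends a₁ a₂ Set.univ {W | b ∈ W}
  rw [clusterInEvent_univ, Set.univ_inter, ← connEvent_eq_clusterInEvent, Set.inter_comm] at h2
  rw [← h1, ← h2, ← expect_const_mul, ← expect_sub]
  congr 1
  funext ω
  simp only [Pi.sub_apply, Set.indicator_univ, Pi.one_apply, one_mul]
  ring

/-- **Harris in `G ∖ K`**: `crossAfo ≥ E[1[v ∈ K]·(π_o − g_o)(π_b − g_b)·1_Q]`. -/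
lemma crossAfo_ge (hq : IsProbVec q) (o a₁ a₂ v b : V) :
    expect q (fun ω => ({W : Set V | v ∈ W}.indicator 1 (cluster ends ω a₂) *
        (prob q (connEvent ends a₁ o) - outsideProb q ends a₁ {W | o ∈ W} (cluster ends ω a₂))) *
        (prob q (connEvent ends a₁ b) - outsideProb q ends a₁ {W | b ∈ W} (cluster ends ω a₂)) *
        (avoidAll ends a₂ {a₁}).indicator (1 : Config E → R) ω) ≤
      crossAfo q ends o a₁ a₂ v b := by
  rw [crossAfo_eq_expect]
  refine expect_mono hq fun ω => ?_
  rw [indicator_Q_eq_outsideProb_univ]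
  have hind := indicator_mem_nonneg (R := R) v (cluster ends ω a₂)
  by_cases ha : a₁ ∈ cluster ends ω a₂
  · rw [outsideProb_apply_of_mem q _ ha, outsideProb_apply_of_mem q _ ha,
      outsideProb_apply_of_mem q _ ha, outsideProb_apply_of_mem q _ ha]
    ring_nf
    exact le_rfl
  · rw [outsideProb_apply_of_notMem q _ ha, outsideProb_apply_of_notMem q _ ha,
      outsideProb_apply_of_notMem q _ ha, outsideProb_apply_of_notMem q _ ha, delClusterProb_univ]
    have hH := delClusterProb_mul_le_inter q hq ends a₁ b o (cluster ends ω a₂)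
    nlinarith [mul_nonneg hind (sub_nonneg.2 hH)]

/-- **Positive association, first pairing**:
`(π_o P(Q,vH) − P(Q,vH,oL))·(π_b Z − P(Q,bL)) ≤ Z·crossAfo`. -/
lemma pa_bound_vo (hq : IsProbVec q) (o a₁ a₂ v b : V) :
    (prob q (connEvent ends a₁ o) * prob q (avoidAll ends a₂ {a₁} ∩ connEvent ends a₂ v) -
        prob q (avoidAll ends a₂ {a₁} ∩ (connEvent ends a₂ v ∩ connEvent ends a₁ o))) *
      (prob q (connEvent ends a₁ b) * prob q (avoidAll ends a₂ {a₁}) -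
        prob q (avoidAll ends a₂ {a₁} ∩ connEvent ends a₁ b)) ≤
    prob q (avoidAll ends a₂ {a₁}) * crossAfo q ends o a₁ a₂ v b := by
  have hF₁ : Monotone (fun W : Set V => {W : Set V | v ∈ W}.indicator (1 : Set V → R) W *
      (prob q (connEvent ends a₁ o) - outsideProb q ends a₁ {W | o ∈ W} W)) := fun W W' h =>
    mul_le_mul (indicator_mem_mono v h) (slackFun_mono q ends hq a₁ o h)
      (slackFun_nonneg q ends hq a₁ o W) (indicator_mem_nonneg v W')
  have hF₁0 : ∀ W : Set V, 0 ≤ {W : Set V | v ∈ W}.indicator (1 : Set V → R) W *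
      (prob q (connEvent ends a₁ o) - outsideProb q ends a₁ {W | o ∈ W} W) := fun W =>
    mul_nonneg (indicator_mem_nonneg v W) (slackFun_nonneg q ends hq a₁ o W)
  have key := bhk_univ_avoid q hq ends a₂ {a₁} hF₁ (slackFun_mono q ends hq a₁ b) hF₁0
    (slackFun_nonneg q ends hq a₁ b)
  beta_reduce at key
  rw [expect_vslack, expect_slack] at key
  have hle := crossAfo_ge q ends hq o a₁ a₂ v b
  have hZ := prob_nonneg hq (avoidAll ends a₂ {a₁})
  calc _ ≤ _ := key
    _ ≤ _ := by nlinarith [mul_le_mul_of_nonneg_right hle hZ]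

/-- **Positive association, second pairing**:
`(π_b P(Q,vH) − P(Q,vH,bL))·(π_o Z − P(Q,oL)) ≤ Z·crossAfo`. -/
lemma pa_bound_vb (hq : IsProbVec q) (o a₁ a₂ v b : V) :
    (prob q (connEvent ends a₁ b) * prob q (avoidAll ends a₂ {a₁} ∩ connEvent ends a₂ v) -
        prob q (avoidAll ends a₂ {a₁} ∩ (connEvent ends a₂ v ∩ connEvent ends a₁ b))) *
      (prob q (connEvent ends a₁ o) * prob q (avoidAll ends a₂ {a₁}) -
        prob q (avoidAll ends a₂ {a₁} ∩ connEvent ends a₁ o)) ≤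
    prob q (avoidAll ends a₂ {a₁}) * crossAfo q ends o a₁ a₂ v b := by
  have hF₁ : Monotone (fun W : Set V => {W : Set V | v ∈ W}.indicator (1 : Set V → R) W *
      (prob q (connEvent ends a₁ b) - outsideProb q ends a₁ {W | b ∈ W} W)) := fun W W' h =>
    mul_le_mul (indicator_mem_mono v h) (slackFun_mono q ends hq a₁ b h)
      (slackFun_nonneg q ends hq a₁ b W) (indicator_mem_nonneg v W')
  have hF₁0 : ∀ W : Set V, 0 ≤ {W : Set V | v ∈ W}.indicator (1 : Set V → R) W *
      (prob q (connEvent ends a₁ b) - outsideProb q ends a₁ {W | b ∈ W} W) := fun W =>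
    mul_nonneg (indicator_mem_nonneg v W) (slackFun_nonneg q ends hq a₁ b W)
  have key := bhk_univ_avoid q hq ends a₂ {a₁} hF₁ (slackFun_mono q ends hq a₁ o) hF₁0
    (slackFun_nonneg q ends hq a₁ o)
  beta_reduce at key
  rw [expect_vslack, expect_slack] at key
  have hle := crossAfo_ge q ends hq o a₁ a₂ v b
  have hZ := prob_nonneg hq (avoidAll ends a₂ {a₁})
  -- the product `1[v ∈ K](π_b − g_b)·(π_o − g_o)` is the integrand of `crossAfo_ge` up to `ring`
  have hle' : expect q (fun ω => ({W : Set V | v ∈ W}.indicator 1 (cluster ends ω a₂) *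
        (prob q (connEvent ends a₁ b) - outsideProb q ends a₁ {W | b ∈ W} (cluster ends ω a₂))) *
        (prob q (connEvent ends a₁ o) - outsideProb q ends a₁ {W | o ∈ W} (cluster ends ω a₂)) *
        (avoidAll ends a₂ {a₁}).indicator (1 : Config E → R) ω) ≤ crossAfo q ends o a₁ a₂ v b := by
    refine le_trans (le_of_eq ?_) hle
    congr 1
    funext ω
    ring
  calc _ ≤ _ := key
    _ ≤ _ := by nlinarith [mul_le_mul_of_nonneg_right hle' hZ]

/-- **THEOREM: `crossAso ≥ 0`** — `crossAso = 2Z·crossAfo − P₁ − P₂` with `P₁, P₂ ≤ Z·crossAfo`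
by positive association (`pa_bound_vo`, `pa_bound_vb`). -/
theorem crossAso_nonneg (hq : IsProbVec q) (o a₁ a₂ v b : V) :
    0 ≤ crossAso q ends o a₁ a₂ v b := by
  have h1 := pa_bound_vo q ends hq o a₁ a₂ v b
  have h2 := pa_bound_vb q ends hq o a₁ a₂ v b
  have key : crossAso q ends o a₁ a₂ v b =
      2 * (prob q (avoidAll ends a₂ {a₁}) * crossAfo q ends o a₁ a₂ v b) -
        (prob q (connEvent ends a₁ o) * prob q (avoidAll ends a₂ {a₁} ∩ connEvent ends a₂ v) -
            prob q (avoidAll ends a₂ {a₁} ∩ (connEvent ends a₂ v ∩ connEvent ends a₁ o))) *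
          (prob q (connEvent ends a₁ b) * prob q (avoidAll ends a₂ {a₁}) -
            prob q (avoidAll ends a₂ {a₁} ∩ connEvent ends a₁ b)) -
        (prob q (connEvent ends a₁ b) * prob q (avoidAll ends a₂ {a₁} ∩ connEvent ends a₂ v) -
            prob q (avoidAll ends a₂ {a₁} ∩ (connEvent ends a₂ v ∩ connEvent ends a₁ b))) *
          (prob q (connEvent ends a₁ o) * prob q (avoidAll ends a₂ {a₁}) -
            prob q (avoidAll ends a₂ {a₁} ∩ connEvent ends a₁ o)) := by
    unfold crossAso crossAfo
    ring
  rw [key]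
  linarith

end CrossA

end LeafRowPendantRootSOPA

end Summit.Ventures.PercRepro2
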